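import Mathlib
import Summits.Ventures.PercRepro2.Defs
import Summits.Ventures.PercRepro2.Harris
import Summits.Ventures.PercRepro2.Graph
import Summits.Ventures.PercRepro2.Induced
import Summits.Ventures.PercRepro2.VdBKahn
import Summits.Ventures.PercRepro2.NestIID
import Summits.Ventures.PercRepro2.ZMeanBound
import Summits.Ventures.PercRepro2.SideDefs
import Summits.Ventures.PercRepro2.SideLogSupermod

/-!
# From a log-supermodular cluster law to a log-supermodular status law, hence to (SIDE)
(blind cell PercRepro2, mine-1 g12; proofs/MINE1-SIDE.md §7)

The status map `c ↦ c ∩ F` is a lattice homomorphism `Finset V → Finset V`, and the status mass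
`statusMass T F S = P(C ∩ F = S, C ∩ T = ∅)` is the pushforward of the cluster law
`clusterMass c = P(C = c)` along it (restricted to clusters avoiding `T`). The four functions
theorem (Ahlswede–Daykin, Mathlib `four_functions_theorem_univ` on the distributive lattice
`Finset V`) therefore transports the FKG lattice condition from the cluster law to the status law:
`ClusterLogSupermod → StatusLogSupermod` (`statusLogSupermod_of_clusterLogSupermod`), and with
`sideIneq_of_statusLogSupermod` this gives `ClusterLogSupermod → SideIneq`
(`sideIneq_of_clusterLogSupermod`).

On a FOREST the cluster law is log-MODULAR on the lattice of rooted subtrees (edge sets and boundary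
multisets add exactly; proofs/MINE1-SIDE.md §7 (i)), so on forests the side-sign inequality and the
W-inequality hold; on general graphs `ClusterLogSupermod` fails (the intersection of two rooted
connected sets need not be connected) and (SIDE) is false (§8) — the hypothesis is exactly the
mechanism.
-/

namespace Summit.Ventures.PercRepro2

section SideCluster

variable {V : Type*} {E : Type*} [Fintype E] [DecidableEq E] [Fintype V] [DecidableEq V]
  {R : Type*} [CommRing R] [LinearOrder R] [IsStrictOrderedRing R]

variable (p : E → R) (ends : E → Sym2 V) (s : V)

/-- The cluster law `P(C(s) = c)` as a function of the vertex set `c`. -/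
noncomputable def clusterMass (c : Finset V) : R := prob p (clusterEvent ends s (↑c : Set V))

/-- The FKG lattice condition for the cluster law on `Finset V`:
`P(C = c) · P(C = c') ≤ P(C = c ∩ c') · P(C = c ∪ c')`. -/
def ClusterLogSupermod : Prop :=
  ∀ c c' : Finset V, clusterMass p ends s c * clusterMass p ends s c' ≤
    clusterMass p ends s (c ∩ c') * clusterMass p ends s (c ∪ c')

variable {p}

omit [Fintype V] [LinearOrder R] [IsStrictOrderedRing R] in
/-- The empty event has probability zero. -/
lemma prob_empty_eq_zero : prob p (∅ : Set (Config E)) = 0 := by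
  simp [prob]

omit [LinearOrder R] [IsStrictOrderedRing R] in
/-- On `{C = c}` the event `{S ⊆ C, C ∩ X = ∅}` is decided by `c`. -/
lemma prob_clusterEvent_inter_conn_avoid (c S X : Finset V) :
    prob p (clusterEvent ends s (↑c : Set V) ∩ (connAll ends s S ∩ avoidAll ends s X)) =
      if S ⊆ c ∧ ∀ x ∈ X, x ∉ c then clusterMass p ends s c else 0 := by
  unfold clusterMass
  split_ifs with h
  · congr 1
    ext ω
    simp only [Set.mem_inter_iff, mem_clusterEvent, connAll, avoidAll, Set.mem_setOf_eq]
    constructor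
    · rintro ⟨hc, _⟩; exact hc
    · intro hc
      refine ⟨hc, ?_, ?_⟩
      · intro a ha
        have : a ∈ cluster ends ω s := by rw [hc]; exact Finset.mem_coe.mpr (h.1 ha)
        exact this
      · intro x hx hconn
        have : x ∈ cluster ends ω s := hconn
        rw [hc] at this
        exact h.2 x hx (Finset.mem_coe.mp this)
  · rw [← prob_empty_eq_zero (p := p)]
    congr 1
    ext ω
    simp only [Set.mem_inter_iff, mem_clusterEvent, connAll, avoidAll, Set.mem_setOf_eq,
      Set.mem_empty_iff_false, iff_false, not_and]
    intro hc hS hX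
    apply h
    refine ⟨fun a ha => ?_, fun x hx hxc => ?_⟩
    · have : a ∈ cluster ends ω s := hS a ha
      rw [hc] at this
      exact Finset.mem_coe.mp this
    · apply hX x hx
      show x ∈ cluster ends ω s
      rw [hc]; exact Finset.mem_coe.mpr hxc

omit [LinearOrder R] [IsStrictOrderedRing R] in
/-- The status mass is the cluster law pushed forward along `c ↦ c ∩ F` (restricted to `C ∩ T = ∅`). -/
lemma statusMass_eq_sum_clusterMass (T F S : Finset V) :
    statusMass p ends s T F S =
      ∑ c : Finset V, clusterMass p ends s c *
        (if S ⊆ c ∧ ∀ x ∈ T ∪ (F \ S), x ∉ c then 1 else 0) := by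
  unfold statusMass
  rw [prob_eq_sum_clusterEvent p ends s]
  refine Finset.sum_congr rfl fun c _ => ?_
  rw [prob_clusterEvent_inter_conn_avoid]
  split_ifs <;> simp

/-- **Four functions**: a log-supermodular cluster law has a log-supermodular status law. -/
theorem statusLogSupermod_of_clusterLogSupermod (hp : IsProbVec p)
    (hc : ClusterLogSupermod p ends s) (T F : Finset V) : StatusLogSupermod p ends s T F := by
  intro S S' hS hS'
  classical
  let χ : Finset V → Finset V → R := fun S c =>
    if S ⊆ c ∧ ∀ x ∈ T ∪ (F \ S), x ∉ c then 1 else 0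
  have hm0 : ∀ c, 0 ≤ clusterMass p ends s c := fun c => prob_nonneg hp _
  have hχ0 : ∀ S c, 0 ≤ χ S c := fun S c => by simp only [χ]; split_ifs <;> norm_num
  rw [statusMass_eq_sum_clusterMass, statusMass_eq_sum_clusterMass,
    statusMass_eq_sum_clusterMass, statusMass_eq_sum_clusterMass]
  refine four_functions_theorem_univ (fun c => clusterMass p ends s c * χ S c)
    (fun c => clusterMass p ends s c * χ S' c) (fun c => clusterMass p ends s c * χ (S ∩ S') c)
    (fun c => clusterMass p ends s c * χ (S ∪ S') c)
    (fun c => mul_nonneg (hm0 c) (hχ0 _ c)) (fun c => mul_nonneg (hm0 c) (hχ0 _ c))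
    (fun c => mul_nonneg (hm0 c) (hχ0 _ c)) (fun c => mul_nonneg (hm0 c) (hχ0 _ c)) ?_
  intro a b
  simp only [χ]
  by_cases ha : S ⊆ a ∧ ∀ x ∈ T ∪ (F \ S), x ∉ a
  · by_cases hb : S' ⊆ b ∧ ∀ x ∈ T ∪ (F \ S'), x ∉ b
    · have hab : S ∩ S' ⊆ a ⊓ b ∧ ∀ x ∈ T ∪ (F \ (S ∩ S')), x ∉ a ⊓ b := by
        refine ⟨Finset.inter_subset_inter ha.1 hb.1, ?_⟩
        intro x hx hxab
        rw [Finset.inf_eq_inter, Finset.mem_inter] at hxab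
        rcases Finset.mem_union.mp hx with hxT | hxF
        · exact ha.2 x (Finset.mem_union_left _ hxT) hxab.1
        · rw [Finset.mem_sdiff, Finset.mem_inter, not_and_or] at hxF
          rcases hxF.2 with hxS | hxS'
          · exact ha.2 x (Finset.mem_union_right _ (Finset.mem_sdiff.mpr ⟨hxF.1, hxS⟩)) hxab.1
          · exact hb.2 x (Finset.mem_union_right _ (Finset.mem_sdiff.mpr ⟨hxF.1, hxS'⟩)) hxab.2
      have hab' : S ∪ S' ⊆ a ⊔ b ∧ ∀ x ∈ T ∪ (F \ (S ∪ S')), x ∉ a ⊔ b := by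
        refine ⟨Finset.union_subset_union ha.1 hb.1, ?_⟩
        intro x hx hxab
        rw [Finset.sup_eq_union, Finset.mem_union] at hxab
        rcases Finset.mem_union.mp hx with hxT | hxF
        · rcases hxab with hxa | hxb
          · exact ha.2 x (Finset.mem_union_left _ hxT) hxa
          · exact hb.2 x (Finset.mem_union_left _ hxT) hxb
        · rw [Finset.mem_sdiff, Finset.mem_union, not_or] at hxF
          rcases hxab with hxa | hxb
          · exact ha.2 x (Finset.mem_union_right _ (Finset.mem_sdiff.mpr ⟨hxF.1, hxF.2.1⟩)) hxa
          · exact hb.2 x (Finset.mem_union_right _ (Finset.mem_sdiff.mpr ⟨hxF.1, hxF.2.2⟩)) hxb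
      rw [if_pos ha, if_pos hb, if_pos hab, if_pos hab']
      simpa using hc a b
    · rw [if_neg hb, mul_zero, mul_zero]
      exact mul_nonneg (mul_nonneg (hm0 _) (hχ0 _ _)) (mul_nonneg (hm0 _) (hχ0 _ _))
  · rw [if_neg ha, mul_zero, zero_mul]
    exact mul_nonneg (mul_nonneg (hm0 _) (hχ0 _ _)) (mul_nonneg (hm0 _) (hχ0 _ _))

/-- **(SIDE) from a log-supermodular cluster law** — the mechanism behind the forest theorem. -/
theorem sideIneq_of_clusterLogSupermod (hp : IsProbVec p) (hc : ClusterLogSupermod p ends s)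
    (T F : Finset V) : SideIneq p ends s T F :=
  sideIneq_of_statusLogSupermod ends s T F hp (statusLogSupermod_of_clusterLogSupermod ends s hp hc T F)

end SideCluster

end Summit.Ventures.PercRepro2
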